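import Summits.AtomisticToContinuum.Crystallization.Theorems.HullExactificationCascadeRobustBarlowTemplateCoveringCriterion
import Summits.AtomisticToContinuum.Crystallization.Theorems.HullExactificationCascadeRobustBarlowTemplateHoneycombContinuous
import Summits.AtomisticToContinuum.Crystallization.Theorems.HullExactificationCascadeRobustBarlowTemplateTransportDefs
import Mathlib.Analysis.Calculus.InverseFunctionTheorem.ApproximatesLinearOn
import Mathlib.Analysis.Normed.Module.FiniteDimension

/-!
# `develop_injective_of_starApprox` for line `registered` (crux `RobustBarlowTemplate`, stmt-AtomisticToContinuum-12088)

Assembly of the registered stub `develop_injective` from the star estimate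
(`injective_starApprox`, sibling file): the soft analysis / topology glue.

**Statement.** Assume the *star estimate*: for every separated configuration `S`, Hägg sequence
`s` and shell covering `Ψ` with the local-similarity property, and every `x ∈ ℝ³`, there are a
linear isometry `A` and a scale `l` with `20 δ ≤ 21 l` such that the piecewise-affine extension
`F := plExtend s (fun t => Ψ (siteAt s t))` of the vertex data `Ψ ∘ siteAt s` satisfies
`‖F y - F y' - l • A (y - y')‖ ≤ (27/40) l ‖y - y'‖` on the ball `ball x (1/6)`.  Then `Ψ` is
injective on the ideal stacking.

**Proof.**  Fix `x` and the data `A`, `l` of the star estimate at `x`; put `T := l • A`, a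
continuous linear automorphism of `ℝ³` with inverse of norm `l⁻¹`.  The estimate says precisely
`ApproximatesLinearOn F T (ball x (1/6)) (27/40 · l)` in the sense of Mathlib, with constant
`27/40 · l < l = ‖T⁻¹‖⁻¹`.  Hence (Mathlib's inverse-function-theorem toolkit):
* `F` is injective on `ball x (1/6)` (directly: `F y = F y'` forces
  `l ‖y - y'‖ ≤ (27/40) l ‖y - y'‖`);
* `F '' ball x (1/6) ⊇ F '' closedBall x (1/12) ⊇ closedBall (F x) ((l - 27/40 l)/12)`
  (`ApproximatesLinearOn.surjOn_closedBall_of_nonlinearRightInverse`), and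
  `(l - 27/40 l)/12 = 13 l/480 ≥ 13 δ/504` uniformly in `x`;
* `map F (𝓝 x) = 𝓝 (F x)` (`ApproximatesLinearOn.map_nhds_eq`), so `F` is an open map.
Since `F` is continuous (`honeycomb_plExtend_continuous`), the covering criterion
`develop_coveringCriterion` (radii `1/6`, `13 δ/504`) shows that `F` is bijective; as `F`
interpolates the vertex data (`honeycomb_plExtend_siteAt`), `Ψ` is injective on the sites.

**Contents.** `assembly_local` (the local analysis at one point), `assembly_bijective`
(bijectivity of a continuous map with a star estimate everywhere),
`develop_injective_of_starApprox` (registered form).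
-/

noncomputable section

namespace Summit.AtomisticToContinuum.Crystallization.Theorems.HullExactificationCascadeRobustBarlowTemplate

open Literature.MathematicalPhysics.StatisticalMechanics

/-- Euclidean `3`-space. -/
local notation "E3" => EuclideanSpace ℝ (Fin 3)

/-- **Local analysis at one point.**  If `‖F y - F y' - l • A (y - y')‖ ≤ (27/40) l ‖y - y'‖` for
`y, y'` in `ball x (1/6)` (`A` a linear isometry, `l > 0`), then `F` is injective on that ball, the
image of the ball contains `ball (F x) (13 l/480)`, and `F` maps the neighbourhood filter of `x`
onto that of `F x`.  (Mathlib's `ApproximatesLinearOn` toolkit applied to `T := l • A`, whose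
inverse `l⁻¹ • A⁻¹` has norm `l⁻¹ < (27/40 · l)⁻¹`.) -/
theorem assembly_local (F : E3 → E3) (A : E3 →ₗᵢ[ℝ] E3) (l : ℝ) (x : E3) (hl : 0 < l)
    (happ : ∀ y ∈ Metric.ball x (1 / 6), ∀ y' ∈ Metric.ball x (1 / 6),
      ‖F y - F y' - l • A (y - y')‖ ≤ 27 / 40 * l * ‖y - y'‖) :
    Set.InjOn F (Metric.ball x (1 / 6)) ∧
      Metric.ball (F x) (13 * l / 480) ⊆ F '' Metric.ball x (1 / 6) ∧
      Filter.map F (nhds x) = nhds (F x) := by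
  -- the approximating continuous linear map `T := l • A`
  obtain ⟨T, hT⟩ : ∃ T : E3 →L[ℝ] E3, ∀ z, T z = l • A z :=
    ⟨l • A.toContinuousLinearMap, fun z => rfl⟩
  obtain ⟨c, hc⟩ : ∃ c : NNReal, (c : ℝ) = 27 / 40 * l :=
    ⟨⟨27 / 40 * l, by positivity⟩, rfl⟩
  have hf : ApproximatesLinearOn F T (Metric.ball x (1 / 6)) c := by
    intro y hy y' hy'
    rw [hT, hc]
    exact happ y hy y' hy'
  -- `A` is onto (finite dimension): upgrade it to a linear isometry equivalence
  obtain ⟨A', hA'⟩ : ∃ A' : E3 ≃ₗᵢ[ℝ] E3, ∀ z, A' z = A z :=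
    ⟨A.toLinearIsometryEquiv rfl, fun z => rfl⟩
  -- the (linear) right inverse `l⁻¹ • A⁻¹` of `T`, of norm `l⁻¹`
  let R : T.NonlinearRightInverse :=
    { toFun := fun z => l⁻¹ • A'.symm z
      nnnorm := ⟨l⁻¹, inv_nonneg.2 hl.le⟩
      bound' := fun z => by
        rw [norm_smul, norm_inv, Real.norm_of_nonneg hl.le, LinearIsometryEquiv.norm_map]
        exact le_rfl
      right_inv' := fun z => by
        rw [hT, LinearIsometry.map_smul, smul_smul, mul_inv_cancel₀ hl.ne', one_smul, ← hA']
        exact A'.apply_symm_apply z }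
  have hRn : (R.nnnorm : ℝ) = l⁻¹ := rfl
  have hclt : c < R.nnnorm⁻¹ := by
    rw [← NNReal.coe_lt_coe, NNReal.coe_inv, hRn, inv_inv, hc]
    linarith
  refine ⟨?_, ?_, hf.map_nhds_eq R (Metric.ball_mem_nhds x (by norm_num)) (Or.inr hclt)⟩
  · -- local injectivity, directly from the estimate
    intro y hy y' hy' hyy
    have h := happ y hy y' hy'
    rw [hyy, sub_self, zero_sub, norm_neg, norm_smul, LinearIsometry.norm_map,
      Real.norm_of_nonneg hl.le] at h
    have h0 : ‖y - y'‖ = 0 := by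
      nlinarith [norm_nonneg (y - y'), mul_pos hl hl]
    exact sub_eq_zero.1 (norm_eq_zero.1 h0)
  · -- local surjectivity
    intro z hz
    have hsurj := hf.surjOn_closedBall_of_nonlinearRightInverse R (b := x) (ε := 1 / 12)
      (by norm_num) (Metric.closedBall_subset_ball (by norm_num))
    rw [hRn, inv_inv, hc] at hsurj
    have hz' : z ∈ Metric.closedBall (F x) ((l - 27 / 40 * l) * (1 / 12)) := by
      rw [Metric.mem_closedBall]
      have hz1 := Metric.mem_ball.1 hz
      linarith
    obtain ⟨w, hw, hwz⟩ := hsurj hz'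
    exact ⟨w, Metric.closedBall_subset_ball (by norm_num) hw, hwz⟩

/-- **Bijectivity from a star estimate everywhere.**  A continuous self-map `F` of `ℝ³` which at
every point admits a star estimate `‖F y - F y' - l • A (y - y')‖ ≤ (27/40) l ‖y - y'‖` on
`ball x (1/6)` with `A` a linear isometry and `20 δ ≤ 21 l` (`δ > 0` fixed) is bijective: it is
open, injective on `1/6`-balls, and images of `1/6`-balls contain the concentric
`13 δ/504`-balls, so the covering criterion `develop_coveringCriterion` applies. -/
theorem assembly_bijective (F : E3 → E3) (δ : ℝ) (hδ : 0 < δ) (hF : Continuous F)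
    (hstar : ∀ x : E3, ∃ (A : E3 →ₗᵢ[ℝ] E3) (l : ℝ), 20 * δ ≤ 21 * l ∧
      ∀ y ∈ Metric.ball x (1 / 6), ∀ y' ∈ Metric.ball x (1 / 6),
        ‖F y - F y' - l • A (y - y')‖ ≤ 27 / 40 * l * ‖y - y'‖) :
    Function.Bijective F := by
  have hc₀ : (0 : ℝ) < 13 * δ / 504 := by positivity
  have hloc : ∀ x : E3, Set.InjOn F (Metric.ball x (1 / 6)) ∧
      Metric.ball (F x) (13 * δ / 504) ⊆ F '' Metric.ball x (1 / 6) ∧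
      Filter.map F (nhds x) = nhds (F x) := by
    intro x
    obtain ⟨A, l, hl, happ⟩ := hstar x
    have hlpos : 0 < l := by linarith
    obtain ⟨h1, h2, h3⟩ := assembly_local F A l x hlpos happ
    refine ⟨h1, Set.Subset.trans (Metric.ball_subset_ball ?_) h2, h3⟩
    linarith
  have hopen : IsOpenMap F := isOpenMap_iff_nhds_le.2 fun x => (hloc x).2.2.ge
  exact develop_coveringCriterion F (1 / 6) (13 * δ / 504) hF hopen (by norm_num) hc₀
    (fun p => (hloc p).1) (fun p => (hloc p).2.1)

/-- **Assembly of `develop_injective` from the star estimate** (registered sub-goal).  Given the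
star estimate (hypothesis; the content of `injective_starApprox`), for every `δ`-separated `S`,
Hägg sequence `s` and shell covering `Ψ` with the local-similarity property, `Ψ` is injective on
the ideal stacking: the piecewise-affine extension `F` of `Ψ ∘ siteAt s` is continuous
(`honeycomb_plExtend_continuous`) and bijective (`assembly_bijective`), and it interpolates the
vertex data (`honeycomb_plExtend_siteAt`), every point of the ideal stacking being a site. -/
theorem develop_injective_of_starApprox : (∀ (δ : ℝ), 0 < δ → ∀ (S : Set E3) (s : ℤ → ℤ) (Ψ : E3 → E3), Sep δ S → IsHaggSeq s → IsShellCovering S s Ψ → LocSim s Ψ → ∀ x : E3, ∃ (v : E3) (A : E3 →ₗᵢ[ℝ] E3) (l : ℝ), v ∈ idealStacking s ∧ 20 * δ ≤ 21 * l ∧ ∀ y ∈ Metric.ball x (1 / 6), ∀ y' ∈ Metric.ball x (1 / 6), ‖plExtend s (fun t => Ψ (siteAt s t)) y - plExtend s (fun t => Ψ (siteAt s t)) y' - l • A (y - y')‖ ≤ 27 / 40 * l * ‖y - y'‖) → ∀ δ : ℝ, 0 < δ → ∀ S : Set E3, Sep δ S → (∀ y ∈ S, Good S y) → Recip S → ∀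 (s : ℤ → ℤ) (Ψ : E3 → E3), IsHaggSeq s → IsShellCovering S s Ψ → LocSim s Ψ → Set.InjOn Ψ (idealStacking s) := by
  intro hstar δ hδ S hsep _ _ s Ψ hs hcov hLS
  have hbij : Function.Bijective (plExtend s (fun t => Ψ (siteAt s t))) :=
    assembly_bijective (plExtend s (fun t => Ψ (siteAt s t))) δ hδ
      (honeycomb_plExtend_continuous s hs _) fun x => by
        obtain ⟨_, A, l, _, hl, happ⟩ := hstar δ hδ S s Ψ hsep hs hcov hLS x
        exact ⟨A, l, hl, happ⟩
  intro p hp p' hp' hpp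
  have hp₁ : p ∈ barlowStacking 1 (Real.sqrt (2 / 3)) s := hp
  have hp₂ : p' ∈ barlowStacking 1 (Real.sqrt (2 / 3)) s := hp'
  obtain ⟨k, i, j, rfl⟩ := mem_barlowStacking_iff.1 hp₁
  obtain ⟨k', i', j', rfl⟩ := mem_barlowStacking_iff.1 hp₂
  have q₁ : barlowPos 1 (Real.sqrt (2 / 3)) s k i j = siteAt s (k, i, j) := rfl
  have q₂ : barlowPos 1 (Real.sqrt (2 / 3)) s k' i' j' = siteAt s (k', i', j') := rfl
  rw [q₁, q₂] at hpp ⊢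
  apply hbij.1
  rw [honeycomb_plExtend_siteAt s hs (fun t => Ψ (siteAt s t)) (k, i, j),
    honeycomb_plExtend_siteAt s hs (fun t => Ψ (siteAt s t)) (k', i', j')]
  exact hpp

end Summit.AtomisticToContinuum.Crystallization.Theorems.HullExactificationCascadeRobustBarlowTemplate

end
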